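import Summits.QuantumFields.YangMills.Theorems.BalabanUVNodesN22AtRecordOfPrintedSlotsClosed
import Summits.QuantumFields.YangMills.Theorems.BalabanUVNodesN22KernelLimitOfRealTwoPointRecord

/-!
# NODE N22 (NE9) — K3⁸ §2b's raw inputs `h9` ∕ `hdec` and the N22 ∕ (D4) pin faces AT THE RECORD in PRINTED-slot currency, the (1.21) EXISTENCE LETTER discharged from
# the activity slots + the CHART-FREE REAL-PROBE cross-volume law (G≈ℝ) — the «(G≈ℝ)-keyed» edition of `…N22AtRecordOfPrintedSlotsClosed`

Cell `pub-ymgap`, Track A (HUMAN RULING D-0062), WIDTH SEAT `dag-n22-w3` g5 on node n22 = NE9; `--kind proof --supports stmt-QuantumFields-27366 --as helper` (KEY MAP v2: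
K3⁸ `SpineGivenEndpointR13SepCoPHV`), COUNT-NEUTRAL; THEOREMS ONLY (0 `def`, 0 `sorry`, standard axioms).  The open one-liner left by this seat's g4 (pub-ymgap INBOX 2026-08-28
12:25Z «the (G≈ℝ)-keyed editions of n22-w5's printed-slot … record files») and by dag-n22-w5 g0′ («NOT mine: n22-w3 g4 (G≈ℝ) real two-point law files»).  dag-n22-w5's
`…N22AtRecordOfPrintedSlotsClosed` (p611990) displays ONE structural law of this seat's (1.21) road, (S≈) «cross-volume stability of the small∕near scalar KERNELS» (second-derivative
level); its (G≈)-keyed edition `…N22AtRecordOfPrintedSlotsTwoPointGenerating` (p619316) moved it to the VALUE level on a complex bidisc through the charts `Φ ∘ ι`; THIS FILE keys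
the same four faces on g4's CHART-FREE law (G≈ℝ) (`…N22KernelLimitOfRealTwoPoint{,Letters,Record}`, p618762 ∕ p619896 ∕ p620925): «the small-domain partial sums of the
FINITE-VOLUME (2.13) terms at Bałaban's own REAL probe families `emb_K(exp θ.ρ8(a·e_{μ,z,c} + b·e_{ν,0,c}))`, `|a|, |b| ≤ r₂`, are `C r₀^K`-close across consecutive volumes»
— [I] p. 264 «Now we take a limit of these functions as T^{(j+1)} ↗ Z^d» verbatim in type, NO complexification in the hypothesis (the complex bound the Cauchy step needs is DERIVED
inside p619896 from `Bound238` + the torus count).  One application each of p611990's faces with `polLimitsExistOfRecord₁₃_of_activitySlots` REPLACED by g4's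
`polLimitsExistOfRecord₁₃_of_realTwoPoint` (p620925 §5), its `hHhol` per prefix from PRINTED `AnalyticH` + holomorphic readings via J32′ §1 `differentiableOn_H_comp_of_analyticH`
exactly as in p619316; nothing of p607522 ∕ p611990 ∕ p618762 ∕ p619896 ∕ p620925 ∕ (A) ∕ (B) ∕ J32′ is re-declared.

WHAT.  ★★★ `ne9_EA_objectsOfRecord₁₃_of_printedSlots_realTwoPoint` (§2b's `h9`: `NE9 ((objectsOfRecord₁₃ F N θ ℓ).EA 0) (Window θ.γ) ℓ.κ ℓ.moduli`), ★★★
`kernelDecayOfRecord₁₃_of_printedSlots_realTwoPoint` (its `hdec`, any `κ′ ≤ δ₁`), ★★★ `n22At_rateCarriers_of_kernels_pin_of_printedSlots_realTwoPoint` and ★★★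
`readOutAt_rateCarriers_of_kernels_pin_of_printedSlots_realTwoPoint` (the N22 ∕ (D4) pin faces for EVERY run length at a reading pinned to the kernel objects of record), from:
the towers∕reading with W1-20's law `Localizes17OfRecord₁₃ F N θ S emb`; W1's THREE slots `Bound238` ∕ `YoungLipschitz` ∕ PRINTED `AnalyticH` on prefix sets `Wk K k` containing the
cut histories of the window; the holomorphic complexified readings `Φ` of the record's β-chart through the real-linear `ι` (chart∕space clauses — still needed by the (5.10) tails and
by the Cauchy step, NOT by the law); the site weights with the minimizer tails ([I] p. 282); Road 1's numerals in p607522's strength; a «small∕near» class `lo` of domains with its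
threshold clause; the probe radius `0 < r₂`, `(2B₃+1)(2r₂) ≤ r`; the DIALS `0 < r₀ ≤ 1`, `0 < s < 1` with the rate numeral `ρ_s = (r₀^{1−s}(L⁴)^{s})^{1−s}(L⁴)^{s} < 1` (satisfiable for
every family: g4's `exists_realTwoPoint_dials`); (G≈ℝ) at rate `r₀` (NODE A ∕ def-W1's — displayed exactly as in p620925, at `θ.ρ8 ∕ θ.bV` on the window `]0, θ.γ]^ℕ`); and a letter
block `ℓ` DOMINATING the engine's constants.  NO kernel-level letter, NO (1.21)-existence hypothesis, NO kernel-level or complex cross-volume law is displayed any more.  A5∕A6: the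
non-record hypotheses are jointly inhabited at the EMPTY towers by p620925's `polLimitsExist_localizedSum_of_realTwoPoint_fires_zeroTower` (with (G≈ℝ) at `C := 0`) + dag-n22-w2's
`…AtSlotsInhabited` + `analyticH_termlessStep` (DEGENERATE, declared; this seat's g5 `…N22KernelLimitOfNestedTermsModel` is the NON-degenerate model inhabitant of the existence
SCHEMAS underneath, not of these record-level faces); the law, (G≈ℝ)'s subject at the record, `θ` and the reading OF RECORD are LOCATED hypotheses, NOT inhabited here.

HONEST FRAMING (binding).  Count-neutral COMPOSITION of landed theorems by name; NO estimate of Bałaban's is proved or asserted; every displayed input is a HYPOTHESIS with its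
owner (W1 slots: N10 ∕ NODE A — the differenced slot NOT PRINTED; readings + tails: NODE A ∕ N09; (G≈ℝ): NODE A ∕ def-W1 — the thermodynamic convergence near the window of the
finite-volume local terms, NOT typed here; law: NODE A ∕ N10); nothing of the record is constructed or claimed to meet them; (1.21)'s existence for the terms OF RECORD is NOT
proved; N22 and (D4) are NOT discharged (typed 28∕28 · discharged 5∕27 UNCHANGED); K3⁸ OPEN and NOT claimed, no stub touched; NE9 is NOT IN PRINT for d = 4; no count claim (the
chair's single count line is the only count); no summit statement is proved by this seat; one finite 𝕋⁴ programme at fixed ε — R4 closes the CONDITIONAL rung `BalabanLadder.UV`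
only; NOTHING about the continuum limit, ℝ⁴, infinite volume, OS axioms, a mass gap or the Clay problem is proved or claimed by any of this.  References (TYPES only, no cite tags on
the Summit side): [I] = Bałaban, CMP 109 (1987) (1.7) p. 261, (1.18) p. 263, (1.20)–(1.21) p. 264, p. 282, (5.10) p. 293; [II] = CMP 116 (1988) (1.26) p. 8, (2.13)–(2.14) pp. 14–15,
(2.38) p. 20.
-/

noncomputable section

open Filter Topology Metric Set
open scoped BigOperators

namespace YMDAG.N22.AtRecordOfPrintedSlots

open Literature.MathematicalPhysics.QuantumFieldTheory.Balaban1983to89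
open Literature.MathematicalPhysics.QuantumFieldTheory.Balaban1983to89.T4Continuum (T4Family ULoop)
open Literature.MathematicalPhysics.QuantumFieldTheory.Balaban1983to89.T4OutputRate (Window NE9)
open Literature.MathematicalPhysics.QuantumFieldTheory.Balaban1983to89.Node00 (polScalar siteOfInt Stage13Params Stage13HParams U3Letters₁₁ MatA datumOfRecord₁₃CoPH)
open Literature.MathematicalPhysics.QuantumFieldTheory.Balaban1983to89.Node00.Sect2 (domCount domSys CPair)
open Literature.MathematicalPhysics.QuantumFieldTheory.Balaban1983to89.Node00.LocalizedSum17 (ReadingMaps Localizes17OfRecord₁₃)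
open Literature.MathematicalPhysics.QuantumFieldTheory.Balaban1983to89.Node00.W1 (ClusterTower ClusterStep)
open Literature.MathematicalPhysics.QuantumFieldTheory.Balaban1983to89.Node00.U3OfKernels (histPrefix objectsOfRecord₁₃ KernelDecayOfRecord₁₃)
open Literature.MathematicalPhysics.QuantumFieldTheory.Balaban1983to89.Node00.U3KernelLetters (PolLimitsExistOfRecord₁₃)
open Literature.MathematicalPhysics.QuantumFieldTheory.Balaban1983to89.B12Decay510 (delta1)
open Literature.MathematicalPhysics.QuantumFieldTheory.Balaban1983to89.B12Decay510Window (K₁)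
open Literature.MathematicalPhysics.QuantumFieldTheory.Balaban1983to89.B12Decay510Torus (distCT nearT)
open Literature.MathematicalPhysics.QuantumFieldTheory.Balaban1983to89.B12TreeDecay (K₀ kappa₀ K₀_pos)
open Literature.MathematicalPhysics.QuantumFieldTheory.Balaban1983to89.TreeLengthTorus (TPt torusTreeLen)
open Literature.MathematicalPhysics.QuantumFieldTheory.Balaban1983to89.B12Sec2to5 (betaPrime510)
open YMDAG.UVSplit (N22At ReadOutAt RateReading₁₃CoPH rateCarriersOfRecord₁₃CoPH)
open YMDAG.N22.AtKernels (polLimitsExistOfRecord₁₃_of_realTwoPoint)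
open YMDAG.N22.WindowedOfCouplingHolo (differentiableOn_H_comp_of_analyticH)

open scoped Matrix.Norms.L2Operator

variable (F : T4Family) (N : ℕ) [NeZero N]

/-! ## §1 `h9` and `hdec`, `hlim` discharged from the activity slots + (G≈ℝ) -/

open Classical in
/-- ★★★ **THE `h9` OF K3⁸ §2b IN PRINTED-SLOT CURRENCY, (1.21)-EXISTENCE DISCHARGED FROM THE ACTIVITY SLOTS + THE CHART-FREE REAL-PROBE LAW (G≈ℝ).**
`ne9_EA_objectsOfRecord₁₃_of_printedSlots` (p608801) with `hlim` := dag-n22-w3 g4's `polLimitsExistOfRecord₁₃_of_realTwoPoint` (p620925 §5; its `hHhol` per prefix from PRINTED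
`AnalyticH` + holomorphic readings via J32′ §1): law + W1's THREE slots + readings + tails + numerals (p607522's strength) + the small∕near class `lo` + the probe radius `r₂`
(`(2B₃+1)(2r₂) ≤ r`) + the dials `(r₀, s)` with `ρ_s < 1` + (G≈ℝ) at the real probe families + a dominating letter block ⟹ `NE9 ((objectsOfRecord₁₃ F N θ ℓ).EA 0) (Window θ.γ) ℓ.κ ℓ.moduli`.
LOCATED (hypothesis form); N22 NOT discharged. -/
theorem ne9_EA_objectsOfRecord₁₃_of_printedSlots_realTwoPoint (θ : Stage13Params F N) (ℓ : U3Letters₁₁) (hs : ℓ.Signs)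
    (m' : ℕ) (M : ℕ) [NeZero M] (hM : M = F.L ^ m')
    (S : (K : ℕ) → ClusterTower (F.P K) (MatA N) M) (emb : ReadingMaps F (MatA N) (MatA N)) (hloc : Localizes17OfRecord₁₃ F N θ S emb)
    (Wk : (K k : ℕ) → Set (Fin (k + 1) → ℝ)) (hWk : ∀ g ∈ Window θ.γ, ∀ K k, histPrefix g k ∈ Wk K k)
    (sp : (K k : ℕ) → (domSys (F.P K) M (k + 1)).Dom → Set (CPair (F.P K) (MatA N)))
    {A R r₁ κ δ₀ B₃ r r₂ r₀ s : ℝ} (Λ : ℕ → ℕ → ℝ)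
    (hA : 0 < A) (hr₁ : 0 ≤ r₁) (hκ0 : 0 < κ) (hκ : κ ≤ r₁) (hκ4 : kappa₀ (4 * 2 ^ 4) (2 * 4) ≤ κ / 2 / 2) (hrate : r₁ + 2 * (64 * Real.log 162) + 2 ≤ R)
    (hsmall : 2 * A * Real.exp (5 * r₁ + 1) * K₀ 64 8 * 9 * 64 ≤ 1) (hΛ : ∀ k i, 0 ≤ Λ k i) (hδ₀ : 0 < δ₀) (hB₃ : 0 ≤ B₃) (hr : 0 < r)
    (h238 : ∀ K k, ((S K) k).Bound238 (Wk K k) (sp K k) A R)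
    (hYL : ∀ K k, ((S K) k).YoungLipschitz (Wk K k) (sp K k) (fun i : Fin (k + 1) => Λ (k + 1) i) R)
    (hAn : ∀ K k, ((S K) k).AnalyticH (Wk K k) (sp K k))
    (Ec : ℕ → ℕ → Type*) [∀ K k, NormedAddCommGroup (Ec K k)] [∀ K k, NormedSpace ℂ (Ec K k)]
    (ι : letI := θ.instVβ₁; letI := θ.instVβ₂
      (K k : ℕ) → (domSys (F.P K) M (k + 1)).Dom → ((Fin (F.P K).d → Site (F.P K) (k + 1) → θ.Vβ) →L[ℝ] Ec K k))
    (Φ : (K k : ℕ) → (domSys (F.P K) M (k + 1)).Dom → Ec K k → CPair (F.P K) (MatA N))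
    (U : (K k : ℕ) → (domSys (F.P K) M (k + 1)).Dom → Set (Ec K k)) (hU : ∀ K k X, IsOpen (U K k X)) (hrU : ∀ K k X, ball (0 : Ec K k) r ⊆ U K k X)
    (hΦhol : ∀ (K k : ℕ) (X : (domSys (F.P K) M (k + 1)).Dom), DifferentiableOn ℂ (Φ K k X) (U K k X))
    (hΦemb : letI := θ.instVβ₁; letI := θ.instVβ₂
      ∀ (K k : ℕ) (X : (domSys (F.P K) M (k + 1)).Dom) (B : Fin (F.P K).d → Site (F.P K) (k + 1) → θ.Vβ),
        Φ K k X (ι K k X B) = emb K k (fun l t => NormedSpace.exp (θ.ρ8 (B l t))))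
    (hΦsp : ∀ (K k : ℕ) (X : (domSys (F.P K) M (k + 1)).Dom), ∀ z ∈ U K k X, ∀ Z : (domSys (F.P K) M (k + 1)).Dom, Z.1 ⊆ X.1 → Φ K k X z ∈ sp K k Z)
    (w : (K k : ℕ) → (domSys (F.P K) M (k + 1)).Dom → Site (F.P K) (k + 1) → ℝ) (hw₀ : ∀ K k X t, 0 ≤ w K k X t)
    (hw : letI := θ.instVβ₁; letI := θ.instVβ₂; letI := θ.instιβ
      ∀ (K k : ℕ) (X : (domSys (F.P K) M (k + 1)).Dom) (l : Fin (F.P K).d) (t : Site (F.P K) (k + 1)) (c : θ.ιβ),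
        ‖ι K k X (Pi.single l (Pi.single t (θ.bV c)))‖ ≤ w K k X t)
    (htail : ∀ (K k : ℕ) (X : (domSys (F.P K) M (k + 1)).Dom) (t : Site (F.P K) (k + 1)),
      let e : Site (F.P K) (k + 1) → TPt 4 (domCount (F.P K) M (k + 1) * M) := fun x i => (ZMod.cast (x i) : ZMod (domCount (F.P K) M (k + 1) * M))
      w K k X t ≤ B₃ * Real.exp (-δ₀ * distCT (domCount (F.P K) M (k + 1)) M (e t) (nearT (M := M) (e t) X)))
    (lo : (k K : ℕ) → (domSys (F.P K) M (k + 1)).Dom → Prop) [∀ k K, DecidablePred (lo k K)]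
    (hlo : ∀ (k K : ℕ) (X : (domSys (F.P K) M (k + 1)).Dom), ¬ lo k K X →
      let e : Site (F.P K) (k + 1) → TPt 4 (domCount (F.P K) M (k + 1) * M) := fun x i => (ZMod.cast (x i) : ZMod (domCount (F.P K) M (k + 1) * M))
      (K : ℝ) ≤ torusTreeLen X.1 ∨ (K : ℝ) ≤ distCT (domCount (F.P K) M (k + 1)) M (e (siteOfInt F K (k + 1) 0)) (nearT (M := M) (e (siteOfInt F K (k + 1) 0)) X))
    (hr₂ : 0 < r₂) (hr₂r : (2 * B₃ + 1) * (2 * r₂) ≤ r) (hs0 : 0 < s) (hs1 : s < 1) (hr₀pos : 0 < r₀) (hr₀1 : r₀ ≤ 1)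
    (hρ : (r₀ ^ (1 - s) * ((F.L : ℝ) ^ 4) ^ s) ^ (1 - s) * ((F.L : ℝ) ^ 4) ^ s < 1)
    (hGR : letI := θ.instVβ₁; letI := θ.instVβ₂; letI := θ.instιβ
      ∀ g ∈ Window θ.γ, ∀ (k : ℕ) (μ ν : Fin 4) (z : Fin 4 → ℤ), ∃ (K₀ : ℕ) (C : ℝ), ∀ K : ℕ, K₀ ≤ K → ∀ (c : θ.ιβ) (a b : ℝ), |a| ≤ r₂ → |b| ≤ r₂ →
      ‖∑ X ∈ Finset.univ.filter (lo k (K + 1)), ((S (K + 1)) k).E (histPrefix g k) (emb (K + 1) k (fun l t => NormedSpace.exp (θ.ρ8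
          ((a • (Pi.single (Fin.cast (F.P_d (K + 1)).symm μ) (Pi.single (siteOfInt F (K + 1) (k + 1) z) (θ.bV c)) : Fin (F.P (K + 1)).d → Site (F.P (K + 1)) (k + 1) → θ.Vβ) +
            b • (Pi.single (Fin.cast (F.P_d (K + 1)).symm ν) (Pi.single (siteOfInt F (K + 1) (k + 1) 0) (θ.bV c)) : Fin (F.P (K + 1)).d → Site (F.P (K + 1)) (k + 1) → θ.Vβ)) l t)))) X -
        ∑ X ∈ Finset.univ.filter (lo k K), ((S K) k).E (histPrefix g k) (emb K k (fun l t => NormedSpace.exp (θ.ρ8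
          ((a • (Pi.single (Fin.cast (F.P_d K).symm μ) (Pi.single (siteOfInt F K (k + 1) z) (θ.bV c)) : Fin (F.P K).d → Site (F.P K) (k + 1) → θ.Vβ) +
            b • (Pi.single (Fin.cast (F.P_d K).symm ν) (Pi.single (siteOfInt F K (k + 1) 0) (θ.bV c)) : Fin (F.P K).d → Site (F.P K) (k + 1) → θ.Vβ)) l t)))) X‖ ≤ C * r₀ ^ K)
    (hℓκ : ℓ.κ ≤ delta1 δ₀ κ ((M : ℝ) * 4))
    (hdom : ∀ k i, (16 * (8 * (Real.exp 1 * 9 * 64 * K₀ 64 8 ^ 2)) * B₃ ^ 2 / r ^ 2) *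
        Real.exp (delta1 δ₀ κ ((M : ℝ) * 4) * ((M : ℝ) * 4) * 3) * K₀ (4 * 2 ^ 4) (2 * 4) * K₁ 4 (δ₀ / 2) * Λ k i ≤ ℓ.moduli k i) :
    NE9 ((objectsOfRecord₁₃ F N θ ℓ).EA 0) (Window θ.γ) ℓ.κ ℓ.moduli :=
  ne9_EA_objectsOfRecord₁₃_of_printedSlots F N θ ℓ hs
    (polLimitsExistOfRecord₁₃_of_realTwoPoint F N θ m' hM S emb hloc Wk hWk sp hA.le hr₁ hκ0 hκ hκ4 hrate (smallness_of_doubled hA.le hsmall) hB₃ hδ₀ hr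
      h238 Ec ι Φ U hU hrU
      (fun K k _ hh X Z hZ => differentiableOn_H_comp_of_analyticH ((S K) k) (Wk K k) (sp K k) (hAn K k) hh (Φ K k X) (hΦhol K k X) X
        (hΦsp K k X) Z hZ)
      hΦemb hΦsp w hw₀ hw htail lo hlo hr₂ hr₂r hs0 hs1 hr₀pos hr₀1 hρ hGR)
    m' M hM S emb hloc Wk hWk sp Λ hA hr₁ hκ (kappa₀_le_half_of_le_quarter hκ0 hκ4) hrate hsmall hΛ hδ₀ hB₃ hr h238 hYL hAn Ec ι Φ U hU hrU hΦhol
    hΦemb hΦsp w hw₀ hw htail hℓκ hdom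

open Classical in
/-- ★★★ **THE `hdec` OF K3⁸ §2b IN PRINTED-SLOT CURRENCY, (1.21)-EXISTENCE DISCHARGED FROM THE ACTIVITY SLOTS + (G≈ℝ)**, at any rate `κ′ ≤ δ₁` (only `Bound238` + `AnalyticH` of
W1's slots are used; single smallness) — `kernelDecayOfRecord₁₃_of_printedSlots` ∘ `polLimitsExistOfRecord₁₃_of_realTwoPoint`.  LOCATED (hypothesis form); (D4) NOT discharged. -/
theorem kernelDecayOfRecord₁₃_of_printedSlots_realTwoPoint (θ : Stage13Params F N)
    (m' : ℕ) (M : ℕ) [NeZero M] (hM : M = F.L ^ m')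
    (S : (K : ℕ) → ClusterTower (F.P K) (MatA N) M) (emb : ReadingMaps F (MatA N) (MatA N)) (hloc : Localizes17OfRecord₁₃ F N θ S emb)
    (Wk : (K k : ℕ) → Set (Fin (k + 1) → ℝ)) (hWk : ∀ g ∈ Window θ.γ, ∀ K k, histPrefix g k ∈ Wk K k)
    (sp : (K k : ℕ) → (domSys (F.P K) M (k + 1)).Dom → Set (CPair (F.P K) (MatA N)))
    {A R r₁ κ δ₀ B₃ r κ' r₂ r₀ s : ℝ}
    (hA : 0 ≤ A) (hr₁ : 0 ≤ r₁) (hκ0 : 0 < κ) (hκ : κ ≤ r₁) (hκ4 : kappa₀ (4 * 2 ^ 4) (2 * 4) ≤ κ / 2 / 2) (hrate : r₁ + 2 * (64 * Real.log 162) + 2 ≤ R)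
    (hsmall : A * Real.exp (5 * r₁ + 1) * K₀ 64 8 * 9 * 64 ≤ 1) (hδ₀ : 0 < δ₀) (hB₃ : 0 ≤ B₃) (hr : 0 < r)
    (h238 : ∀ K k, ((S K) k).Bound238 (Wk K k) (sp K k) A R)
    (hAn : ∀ K k, ((S K) k).AnalyticH (Wk K k) (sp K k))
    (Ec : ℕ → ℕ → Type*) [∀ K k, NormedAddCommGroup (Ec K k)] [∀ K k, NormedSpace ℂ (Ec K k)]
    (ι : letI := θ.instVβ₁; letI := θ.instVβ₂
      (K k : ℕ) → (domSys (F.P K) M (k + 1)).Dom → ((Fin (F.P K).d → Site (F.P K) (k + 1) → θ.Vβ) →L[ℝ] Ec K k))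
    (Φ : (K k : ℕ) → (domSys (F.P K) M (k + 1)).Dom → Ec K k → CPair (F.P K) (MatA N))
    (U : (K k : ℕ) → (domSys (F.P K) M (k + 1)).Dom → Set (Ec K k)) (hU : ∀ K k X, IsOpen (U K k X)) (hrU : ∀ K k X, ball (0 : Ec K k) r ⊆ U K k X)
    (hΦhol : ∀ (K k : ℕ) (X : (domSys (F.P K) M (k + 1)).Dom), DifferentiableOn ℂ (Φ K k X) (U K k X))
    (hΦemb : letI := θ.instVβ₁; letI := θ.instVβ₂
      ∀ (K k : ℕ) (X : (domSys (F.P K) M (k + 1)).Dom) (B : Fin (F.P K).d → Site (F.P K) (k + 1) → θ.Vβ),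
        Φ K k X (ι K k X B) = emb K k (fun l t => NormedSpace.exp (θ.ρ8 (B l t))))
    (hΦsp : ∀ (K k : ℕ) (X : (domSys (F.P K) M (k + 1)).Dom), ∀ z ∈ U K k X, ∀ Z : (domSys (F.P K) M (k + 1)).Dom, Z.1 ⊆ X.1 → Φ K k X z ∈ sp K k Z)
    (w : (K k : ℕ) → (domSys (F.P K) M (k + 1)).Dom → Site (F.P K) (k + 1) → ℝ) (hw₀ : ∀ K k X t, 0 ≤ w K k X t)
    (hw : letI := θ.instVβ₁; letI := θ.instVβ₂; letI := θ.instιβ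
      ∀ (K k : ℕ) (X : (domSys (F.P K) M (k + 1)).Dom) (l : Fin (F.P K).d) (t : Site (F.P K) (k + 1)) (c : θ.ιβ),
        ‖ι K k X (Pi.single l (Pi.single t (θ.bV c)))‖ ≤ w K k X t)
    (htail : ∀ (K k : ℕ) (X : (domSys (F.P K) M (k + 1)).Dom) (t : Site (F.P K) (k + 1)),
      let e : Site (F.P K) (k + 1) → TPt 4 (domCount (F.P K) M (k + 1) * M) := fun x i => (ZMod.cast (x i) : ZMod (domCount (F.P K) M (k + 1) * M))
      w K k X t ≤ B₃ * Real.exp (-δ₀ * distCT (domCount (F.P K) M (k + 1)) M (e t) (nearT (M := M) (e t) X)))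
    (lo : (k K : ℕ) → (domSys (F.P K) M (k + 1)).Dom → Prop) [∀ k K, DecidablePred (lo k K)]
    (hlo : ∀ (k K : ℕ) (X : (domSys (F.P K) M (k + 1)).Dom), ¬ lo k K X →
      let e : Site (F.P K) (k + 1) → TPt 4 (domCount (F.P K) M (k + 1) * M) := fun x i => (ZMod.cast (x i) : ZMod (domCount (F.P K) M (k + 1) * M))
      (K : ℝ) ≤ torusTreeLen X.1 ∨ (K : ℝ) ≤ distCT (domCount (F.P K) M (k + 1)) M (e (siteOfInt F K (k + 1) 0)) (nearT (M := M) (e (siteOfInt F K (k + 1) 0)) X))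
    (hr₂ : 0 < r₂) (hr₂r : (2 * B₃ + 1) * (2 * r₂) ≤ r) (hs0 : 0 < s) (hs1 : s < 1) (hr₀pos : 0 < r₀) (hr₀1 : r₀ ≤ 1)
    (hρ : (r₀ ^ (1 - s) * ((F.L : ℝ) ^ 4) ^ s) ^ (1 - s) * ((F.L : ℝ) ^ 4) ^ s < 1)
    (hGR : letI := θ.instVβ₁; letI := θ.instVβ₂; letI := θ.instιβ
      ∀ g ∈ Window θ.γ, ∀ (k : ℕ) (μ ν : Fin 4) (z : Fin 4 → ℤ), ∃ (K₀ : ℕ) (C : ℝ), ∀ K : ℕ, K₀ ≤ K → ∀ (c : θ.ιβ) (a b : ℝ), |a| ≤ r₂ → |b| ≤ r₂ →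
      ‖∑ X ∈ Finset.univ.filter (lo k (K + 1)), ((S (K + 1)) k).E (histPrefix g k) (emb (K + 1) k (fun l t => NormedSpace.exp (θ.ρ8
          ((a • (Pi.single (Fin.cast (F.P_d (K + 1)).symm μ) (Pi.single (siteOfInt F (K + 1) (k + 1) z) (θ.bV c)) : Fin (F.P (K + 1)).d → Site (F.P (K + 1)) (k + 1) → θ.Vβ) +
            b • (Pi.single (Fin.cast (F.P_d (K + 1)).symm ν) (Pi.single (siteOfInt F (K + 1) (k + 1) 0) (θ.bV c)) : Fin (F.P (K + 1)).d → Site (F.P (K + 1)) (k + 1) → θ.Vβ)) l t)))) X -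
        ∑ X ∈ Finset.univ.filter (lo k K), ((S K) k).E (histPrefix g k) (emb K k (fun l t => NormedSpace.exp (θ.ρ8
          ((a • (Pi.single (Fin.cast (F.P_d K).symm μ) (Pi.single (siteOfInt F K (k + 1) z) (θ.bV c)) : Fin (F.P K).d → Site (F.P K) (k + 1) → θ.Vβ) +
            b • (Pi.single (Fin.cast (F.P_d K).symm ν) (Pi.single (siteOfInt F K (k + 1) 0) (θ.bV c)) : Fin (F.P K).d → Site (F.P K) (k + 1) → θ.Vβ)) l t)))) X‖ ≤ C * r₀ ^ K)
    (hκ' : κ' ≤ delta1 δ₀ κ ((M : ℝ) * 4)) (μ ν : Fin 4) :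
    KernelDecayOfRecord₁₃ F N θ μ ν κ' :=
  kernelDecayOfRecord₁₃_of_printedSlots F N θ
    (polLimitsExistOfRecord₁₃_of_realTwoPoint F N θ m' hM S emb hloc Wk hWk sp hA hr₁ hκ0 hκ hκ4 hrate hsmall hB₃ hδ₀ hr
      h238 Ec ι Φ U hU hrU
      (fun K k _ hh X Z hZ => differentiableOn_H_comp_of_analyticH ((S K) k) (Wk K k) (sp K k) (hAn K k) hh (Φ K k X) (hΦhol K k X) X
        (hΦsp K k X) Z hZ)
      hΦemb hΦsp w hw₀ hw htail lo hlo hr₂ hr₂r hs0 hs1 hr₀pos hr₀1 hρ hGR)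
    m' M hM S emb hloc Wk hWk sp hA hr₁ hκ (kappa₀_le_half_of_le_quarter hκ0 hκ4) hrate hsmall hδ₀ hB₃ hr h238 hAn Ec ι Φ U hU hrU hΦhol hΦemb hΦsp w hw₀ hw
    htail hκ' μ ν

/-! ## §2 The PIN FACES, `hlim` discharged from the activity slots + (G≈ℝ) -/

open Classical in
/-- ★★★ **THE N22 PIN FACE IN PRINTED-SLOT CURRENCY, (1.21)-EXISTENCE DISCHARGED FROM THE ACTIVITY SLOTS + (G≈ℝ)** — `N22At (rateCarriersOfRecord₁₃CoPH 𝔯 F θ hP g₀ os k).u3` for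
EVERY `k` at a reading pinned to the kernel objects of record (`hpin`): the N22 row sentence at (β) in printed currency — «W1-20's law + W1's three slots + complexified minimizer
readings + p. 282 tails + (G≈ℝ) at the real probe families + dials + numerals + a dominating letter block ⇒ `N22At` at the pinned bundle».  LOCATED (hypothesis form); N22 NOT
discharged. -/
theorem n22At_rateCarriers_of_kernels_pin_of_printedSlots_realTwoPoint (𝔯 : RateReading₁₃CoPH N) (θ : Stage13HParams F N) (hP : θ.Provisos₁₃CoPH F N)
    (g₀ : ℕ → ℝ) (os : List (ULoop F)) (ℓ : U3Letters₁₁) (hs : ℓ.Signs) (hpin : (𝔯.lit F θ hP g₀ os).u3 = objectsOfRecord₁₃ F N θ.toStage13Params ℓ)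
    (m' : ℕ) (M : ℕ) [NeZero M] (hM : M = F.L ^ m')
    (S : (K : ℕ) → ClusterTower (F.P K) (MatA N) M) (emb : ReadingMaps F (MatA N) (MatA N)) (hloc : Localizes17OfRecord₁₃ F N θ.toStage13Params S emb)
    (Wk : (K k : ℕ) → Set (Fin (k + 1) → ℝ)) (hWk : ∀ g ∈ Window θ.γ, ∀ K k, histPrefix g k ∈ Wk K k)
    (sp : (K k : ℕ) → (domSys (F.P K) M (k + 1)).Dom → Set (CPair (F.P K) (MatA N)))
    {A R r₁ κ δ₀ B₃ r r₂ r₀ s : ℝ} (Λ : ℕ → ℕ → ℝ)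
    (hA : 0 < A) (hr₁ : 0 ≤ r₁) (hκ0 : 0 < κ) (hκ : κ ≤ r₁) (hκ4 : kappa₀ (4 * 2 ^ 4) (2 * 4) ≤ κ / 2 / 2) (hrate : r₁ + 2 * (64 * Real.log 162) + 2 ≤ R)
    (hsmall : 2 * A * Real.exp (5 * r₁ + 1) * K₀ 64 8 * 9 * 64 ≤ 1) (hΛ : ∀ k i, 0 ≤ Λ k i) (hδ₀ : 0 < δ₀) (hB₃ : 0 ≤ B₃) (hr : 0 < r)
    (h238 : ∀ K k, ((S K) k).Bound238 (Wk K k) (sp K k) A R)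
    (hYL : ∀ K k, ((S K) k).YoungLipschitz (Wk K k) (sp K k) (fun i : Fin (k + 1) => Λ (k + 1) i) R)
    (hAn : ∀ K k, ((S K) k).AnalyticH (Wk K k) (sp K k))
    (Ec : ℕ → ℕ → Type*) [∀ K k, NormedAddCommGroup (Ec K k)] [∀ K k, NormedSpace ℂ (Ec K k)]
    (ι : letI := θ.instVβ₁; letI := θ.instVβ₂
      (K k : ℕ) → (domSys (F.P K) M (k + 1)).Dom → ((Fin (F.P K).d → Site (F.P K) (k + 1) → θ.Vβ) →L[ℝ] Ec K k))
    (Φ : (K k : ℕ) → (domSys (F.P K) M (k + 1)).Dom → Ec K k → CPair (F.P K) (MatA N))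
    (U : (K k : ℕ) → (domSys (F.P K) M (k + 1)).Dom → Set (Ec K k)) (hU : ∀ K k X, IsOpen (U K k X)) (hrU : ∀ K k X, ball (0 : Ec K k) r ⊆ U K k X)
    (hΦhol : ∀ (K k : ℕ) (X : (domSys (F.P K) M (k + 1)).Dom), DifferentiableOn ℂ (Φ K k X) (U K k X))
    (hΦemb : letI := θ.instVβ₁; letI := θ.instVβ₂
      ∀ (K k : ℕ) (X : (domSys (F.P K) M (k + 1)).Dom) (B : Fin (F.P K).d → Site (F.P K) (k + 1) → θ.Vβ),
        Φ K k X (ι K k X B) = emb K k (fun l t => NormedSpace.exp (θ.ρ8 (B l t))))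
    (hΦsp : ∀ (K k : ℕ) (X : (domSys (F.P K) M (k + 1)).Dom), ∀ z ∈ U K k X, ∀ Z : (domSys (F.P K) M (k + 1)).Dom, Z.1 ⊆ X.1 → Φ K k X z ∈ sp K k Z)
    (w : (K k : ℕ) → (domSys (F.P K) M (k + 1)).Dom → Site (F.P K) (k + 1) → ℝ) (hw₀ : ∀ K k X t, 0 ≤ w K k X t)
    (hw : letI := θ.instVβ₁; letI := θ.instVβ₂; letI := θ.instιβ
      ∀ (K k : ℕ) (X : (domSys (F.P K) M (k + 1)).Dom) (l : Fin (F.P K).d) (t : Site (F.P K) (k + 1)) (c : θ.ιβ),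
        ‖ι K k X (Pi.single l (Pi.single t (θ.bV c)))‖ ≤ w K k X t)
    (htail : ∀ (K k : ℕ) (X : (domSys (F.P K) M (k + 1)).Dom) (t : Site (F.P K) (k + 1)),
      let e : Site (F.P K) (k + 1) → TPt 4 (domCount (F.P K) M (k + 1) * M) := fun x i => (ZMod.cast (x i) : ZMod (domCount (F.P K) M (k + 1) * M))
      w K k X t ≤ B₃ * Real.exp (-δ₀ * distCT (domCount (F.P K) M (k + 1)) M (e t) (nearT (M := M) (e t) X)))
    (lo : (k K : ℕ) → (domSys (F.P K) M (k + 1)).Dom → Prop) [∀ k K, DecidablePred (lo k K)]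
    (hlo : ∀ (k K : ℕ) (X : (domSys (F.P K) M (k + 1)).Dom), ¬ lo k K X →
      let e : Site (F.P K) (k + 1) → TPt 4 (domCount (F.P K) M (k + 1) * M) := fun x i => (ZMod.cast (x i) : ZMod (domCount (F.P K) M (k + 1) * M))
      (K : ℝ) ≤ torusTreeLen X.1 ∨ (K : ℝ) ≤ distCT (domCount (F.P K) M (k + 1)) M (e (siteOfInt F K (k + 1) 0)) (nearT (M := M) (e (siteOfInt F K (k + 1) 0)) X))
    (hr₂ : 0 < r₂) (hr₂r : (2 * B₃ + 1) * (2 * r₂) ≤ r) (hs0 : 0 < s) (hs1 : s < 1) (hr₀pos : 0 < r₀) (hr₀1 : r₀ ≤ 1)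
    (hρ : (r₀ ^ (1 - s) * ((F.L : ℝ) ^ 4) ^ s) ^ (1 - s) * ((F.L : ℝ) ^ 4) ^ s < 1)
    (hGR : letI := θ.instVβ₁; letI := θ.instVβ₂; letI := θ.instιβ
      ∀ g ∈ Window θ.γ, ∀ (k : ℕ) (μ ν : Fin 4) (z : Fin 4 → ℤ), ∃ (K₀ : ℕ) (C : ℝ), ∀ K : ℕ, K₀ ≤ K → ∀ (c : θ.ιβ) (a b : ℝ), |a| ≤ r₂ → |b| ≤ r₂ →
      ‖∑ X ∈ Finset.univ.filter (lo k (K + 1)), ((S (K + 1)) k).E (histPrefix g k) (emb (K + 1) k (fun l t => NormedSpace.exp (θ.ρ8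
          ((a • (Pi.single (Fin.cast (F.P_d (K + 1)).symm μ) (Pi.single (siteOfInt F (K + 1) (k + 1) z) (θ.bV c)) : Fin (F.P (K + 1)).d → Site (F.P (K + 1)) (k + 1) → θ.Vβ) +
            b • (Pi.single (Fin.cast (F.P_d (K + 1)).symm ν) (Pi.single (siteOfInt F (K + 1) (k + 1) 0) (θ.bV c)) : Fin (F.P (K + 1)).d → Site (F.P (K + 1)) (k + 1) → θ.Vβ)) l t)))) X -
        ∑ X ∈ Finset.univ.filter (lo k K), ((S K) k).E (histPrefix g k) (emb K k (fun l t => NormedSpace.exp (θ.ρ8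
          ((a • (Pi.single (Fin.cast (F.P_d K).symm μ) (Pi.single (siteOfInt F K (k + 1) z) (θ.bV c)) : Fin (F.P K).d → Site (F.P K) (k + 1) → θ.Vβ) +
            b • (Pi.single (Fin.cast (F.P_d K).symm ν) (Pi.single (siteOfInt F K (k + 1) 0) (θ.bV c)) : Fin (F.P K).d → Site (F.P K) (k + 1) → θ.Vβ)) l t)))) X‖ ≤ C * r₀ ^ K)
    (hℓκ : ℓ.κ ≤ delta1 δ₀ κ ((M : ℝ) * 4))
    (hdom : ∀ k i, (16 * (8 * (Real.exp 1 * 9 * 64 * K₀ 64 8 ^ 2)) * B₃ ^ 2 / r ^ 2) *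
        Real.exp (delta1 δ₀ κ ((M : ℝ) * 4) * ((M : ℝ) * 4) * 3) * K₀ (4 * 2 ^ 4) (2 * 4) * K₁ 4 (δ₀ / 2) * Λ k i ≤ ℓ.moduli k i) (k : ℕ) :
    N22At (rateCarriersOfRecord₁₃CoPH 𝔯 F θ hP g₀ os k).u3 :=
  n22At_rateCarriers_of_kernels_pin_of_printedSlots F N 𝔯 θ hP g₀ os ℓ hs hpin
    (polLimitsExistOfRecord₁₃_of_realTwoPoint F N θ.toStage13Params m' hM S emb hloc Wk hWk sp hA.le hr₁ hκ0 hκ hκ4 hrate (smallness_of_doubled hA.le hsmall) hB₃ hδ₀ hr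
      h238 Ec ι Φ U hU hrU
      (fun K k _ hh X Z hZ => differentiableOn_H_comp_of_analyticH ((S K) k) (Wk K k) (sp K k) (hAn K k) hh (Φ K k X) (hΦhol K k X) X
        (hΦsp K k X) Z hZ)
      hΦemb hΦsp w hw₀ hw htail lo hlo hr₂ hr₂r hs0 hs1 hr₀pos hr₀1 hρ hGR)
    m' M hM S emb hloc Wk hWk sp Λ hA hr₁ hκ (kappa₀_le_half_of_le_quarter hκ0 hκ4) hrate hsmall hΛ hδ₀ hB₃ hr h238 hYL hAn Ec ι Φ U hU hrU hΦhol
    hΦemb hΦsp w hw₀ hw htail hℓκ hdom k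

open Classical in
/-- ★★★ **THE (D4) PIN FACE IN PRINTED-SLOT CURRENCY, (1.21)-EXISTENCE DISCHARGED FROM THE ACTIVITY SLOTS + (G≈ℝ)** — `ReadOutAt (datumOfRecord₁₃CoPH F N θ hP)
(rateCarriersOfRecord₁₃CoPH 𝔯 F θ hP g₀ os k).u3` for EVERY `k` at a reading pinned to the kernel objects of record, for a letter block with `ℓ.Signs`, `0 < ℓ.κ ≤ δ₁`,
`β′₅.₁₀(4,1,ℓ.κ) ≤ ℓ.cr` ((D4) REDUCED to print's (5.10) clause of record by dag-n27-w1; (5.10) NOT discharged).  LOCATED (hypothesis form); (D4) NOT discharged. -/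
theorem readOutAt_rateCarriers_of_kernels_pin_of_printedSlots_realTwoPoint (𝔯 : RateReading₁₃CoPH N) (θ : Stage13HParams F N) (hP : θ.Provisos₁₃CoPH F N)
    (g₀ : ℕ → ℝ) (os : List (ULoop F)) (ℓ : U3Letters₁₁) (hs : ℓ.Signs) (hℓ₀ : 0 < ℓ.κ) (hcr : betaPrime510 4 1 ℓ.κ ≤ ℓ.cr)
    (hpin : (𝔯.lit F θ hP g₀ os).u3 = objectsOfRecord₁₃ F N θ.toStage13Params ℓ)
    (m' : ℕ) (M : ℕ) [NeZero M] (hM : M = F.L ^ m')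
    (S : (K : ℕ) → ClusterTower (F.P K) (MatA N) M) (emb : ReadingMaps F (MatA N) (MatA N)) (hloc : Localizes17OfRecord₁₃ F N θ.toStage13Params S emb)
    (Wk : (K k : ℕ) → Set (Fin (k + 1) → ℝ)) (hWk : ∀ g ∈ Window θ.γ, ∀ K k, histPrefix g k ∈ Wk K k)
    (sp : (K k : ℕ) → (domSys (F.P K) M (k + 1)).Dom → Set (CPair (F.P K) (MatA N)))
    {A R r₁ κ δ₀ B₃ r r₂ r₀ s : ℝ}
    (hA : 0 ≤ A) (hr₁ : 0 ≤ r₁) (hκ0 : 0 < κ) (hκ : κ ≤ r₁) (hκ4 : kappa₀ (4 * 2 ^ 4) (2 * 4) ≤ κ / 2 / 2) (hrate : r₁ + 2 * (64 * Real.log 162) + 2 ≤ R)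
    (hsmall : A * Real.exp (5 * r₁ + 1) * K₀ 64 8 * 9 * 64 ≤ 1) (hδ₀ : 0 < δ₀) (hB₃ : 0 ≤ B₃) (hr : 0 < r)
    (h238 : ∀ K k, ((S K) k).Bound238 (Wk K k) (sp K k) A R)
    (hAn : ∀ K k, ((S K) k).AnalyticH (Wk K k) (sp K k))
    (Ec : ℕ → ℕ → Type*) [∀ K k, NormedAddCommGroup (Ec K k)] [∀ K k, NormedSpace ℂ (Ec K k)]
    (ι : letI := θ.instVβ₁; letI := θ.instVβ₂
      (K k : ℕ) → (domSys (F.P K) M (k + 1)).Dom → ((Fin (F.P K).d → Site (F.P K) (k + 1) → θ.Vβ) →L[ℝ] Ec K k))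
    (Φ : (K k : ℕ) → (domSys (F.P K) M (k + 1)).Dom → Ec K k → CPair (F.P K) (MatA N))
    (U : (K k : ℕ) → (domSys (F.P K) M (k + 1)).Dom → Set (Ec K k)) (hU : ∀ K k X, IsOpen (U K k X)) (hrU : ∀ K k X, ball (0 : Ec K k) r ⊆ U K k X)
    (hΦhol : ∀ (K k : ℕ) (X : (domSys (F.P K) M (k + 1)).Dom), DifferentiableOn ℂ (Φ K k X) (U K k X))
    (hΦemb : letI := θ.instVβ₁; letI := θ.instVβ₂
      ∀ (K k : ℕ) (X : (domSys (F.P K) M (k + 1)).Dom) (B : Fin (F.P K).d → Site (F.P K) (k + 1) → θ.Vβ),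
        Φ K k X (ι K k X B) = emb K k (fun l t => NormedSpace.exp (θ.ρ8 (B l t))))
    (hΦsp : ∀ (K k : ℕ) (X : (domSys (F.P K) M (k + 1)).Dom), ∀ z ∈ U K k X, ∀ Z : (domSys (F.P K) M (k + 1)).Dom, Z.1 ⊆ X.1 → Φ K k X z ∈ sp K k Z)
    (w : (K k : ℕ) → (domSys (F.P K) M (k + 1)).Dom → Site (F.P K) (k + 1) → ℝ) (hw₀ : ∀ K k X t, 0 ≤ w K k X t)
    (hw : letI := θ.instVβ₁; letI := θ.instVβ₂; letI := θ.instιβ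
      ∀ (K k : ℕ) (X : (domSys (F.P K) M (k + 1)).Dom) (l : Fin (F.P K).d) (t : Site (F.P K) (k + 1)) (c : θ.ιβ),
        ‖ι K k X (Pi.single l (Pi.single t (θ.bV c)))‖ ≤ w K k X t)
    (htail : ∀ (K k : ℕ) (X : (domSys (F.P K) M (k + 1)).Dom) (t : Site (F.P K) (k + 1)),
      let e : Site (F.P K) (k + 1) → TPt 4 (domCount (F.P K) M (k + 1) * M) := fun x i => (ZMod.cast (x i) : ZMod (domCount (F.P K) M (k + 1) * M))
      w K k X t ≤ B₃ * Real.exp (-δ₀ * distCT (domCount (F.P K) M (k + 1)) M (e t) (nearT (M := M) (e t) X)))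
    (lo : (k K : ℕ) → (domSys (F.P K) M (k + 1)).Dom → Prop) [∀ k K, DecidablePred (lo k K)]
    (hlo : ∀ (k K : ℕ) (X : (domSys (F.P K) M (k + 1)).Dom), ¬ lo k K X →
      let e : Site (F.P K) (k + 1) → TPt 4 (domCount (F.P K) M (k + 1) * M) := fun x i => (ZMod.cast (x i) : ZMod (domCount (F.P K) M (k + 1) * M))
      (K : ℝ) ≤ torusTreeLen X.1 ∨ (K : ℝ) ≤ distCT (domCount (F.P K) M (k + 1)) M (e (siteOfInt F K (k + 1) 0)) (nearT (M := M) (e (siteOfInt F K (k + 1) 0)) X))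
    (hr₂ : 0 < r₂) (hr₂r : (2 * B₃ + 1) * (2 * r₂) ≤ r) (hs0 : 0 < s) (hs1 : s < 1) (hr₀pos : 0 < r₀) (hr₀1 : r₀ ≤ 1)
    (hρ : (r₀ ^ (1 - s) * ((F.L : ℝ) ^ 4) ^ s) ^ (1 - s) * ((F.L : ℝ) ^ 4) ^ s < 1)
    (hGR : letI := θ.instVβ₁; letI := θ.instVβ₂; letI := θ.instιβ
      ∀ g ∈ Window θ.γ, ∀ (k : ℕ) (μ ν : Fin 4) (z : Fin 4 → ℤ), ∃ (K₀ : ℕ) (C : ℝ), ∀ K : ℕ, K₀ ≤ K → ∀ (c : θ.ιβ) (a b : ℝ), |a| ≤ r₂ → |b| ≤ r₂ →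
      ‖∑ X ∈ Finset.univ.filter (lo k (K + 1)), ((S (K + 1)) k).E (histPrefix g k) (emb (K + 1) k (fun l t => NormedSpace.exp (θ.ρ8
          ((a • (Pi.single (Fin.cast (F.P_d (K + 1)).symm μ) (Pi.single (siteOfInt F (K + 1) (k + 1) z) (θ.bV c)) : Fin (F.P (K + 1)).d → Site (F.P (K + 1)) (k + 1) → θ.Vβ) +
            b • (Pi.single (Fin.cast (F.P_d (K + 1)).symm ν) (Pi.single (siteOfInt F (K + 1) (k + 1) 0) (θ.bV c)) : Fin (F.P (K + 1)).d → Site (F.P (K + 1)) (k + 1) → θ.Vβ)) l t)))) X -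
        ∑ X ∈ Finset.univ.filter (lo k K), ((S K) k).E (histPrefix g k) (emb K k (fun l t => NormedSpace.exp (θ.ρ8
          ((a • (Pi.single (Fin.cast (F.P_d K).symm μ) (Pi.single (siteOfInt F K (k + 1) z) (θ.bV c)) : Fin (F.P K).d → Site (F.P K) (k + 1) → θ.Vβ) +
            b • (Pi.single (Fin.cast (F.P_d K).symm ν) (Pi.single (siteOfInt F K (k + 1) 0) (θ.bV c)) : Fin (F.P K).d → Site (F.P K) (k + 1) → θ.Vβ)) l t)))) X‖ ≤ C * r₀ ^ K)
    (hℓκ : ℓ.κ ≤ delta1 δ₀ κ ((M : ℝ) * 4)) (k : ℕ) :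
    ReadOutAt (datumOfRecord₁₃CoPH F N θ hP) (rateCarriersOfRecord₁₃CoPH 𝔯 F θ hP g₀ os k).u3 :=
  readOutAt_rateCarriers_of_kernels_pin_of_printedSlots F N 𝔯 θ hP g₀ os ℓ hs hℓ₀ hcr hpin
    (polLimitsExistOfRecord₁₃_of_realTwoPoint F N θ.toStage13Params m' hM S emb hloc Wk hWk sp hA hr₁ hκ0 hκ hκ4 hrate hsmall hB₃ hδ₀ hr
      h238 Ec ι Φ U hU hrU
      (fun K k _ hh X Z hZ => differentiableOn_H_comp_of_analyticH ((S K) k) (Wk K k) (sp K k) (hAn K k) hh (Φ K k X) (hΦhol K k X) X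
        (hΦsp K k X) Z hZ)
      hΦemb hΦsp w hw₀ hw htail lo hlo hr₂ hr₂r hs0 hs1 hr₀pos hr₀1 hρ hGR)
    m' M hM S emb hloc Wk hWk sp hA hr₁ hκ (kappa₀_le_half_of_le_quarter hκ0 hκ4) hrate hsmall hδ₀ hB₃ hr h238 hAn Ec ι Φ U hU hrU hΦhol hΦemb hΦsp w hw₀ hw
    htail hℓκ k

end YMDAG.N22.AtRecordOfPrintedSlots

end
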